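import Summits.QuantumFields.YangMills.Theorems.BalabanUVNodesN16Thm4OutputPrint
import Summits.QuantumFields.BalabanUV.T4Continuum.Spine.NE3.PairClassAkB8
import Summits.QuantumFields.BalabanUV.T4Continuum.Spine.NE3.PairReg335B8
import Summits.QuantumFields.BalabanUV.T4Continuum.Spine.NE3.PairFrameCondition
import HarnessLib

/-!
# Route «BalabanUVNodes», cluster K4 «SpineRates» — node N16 = NE3: (T4ᵀ_print-MS) ⟹ (OUT_print-MS) — print's [B8] THEOREM 4 IN THE TORUS GEOMETRY WITH THE
# CONCRETE CONCLUSION SLOT whose (1.36)₃ line is read ALONG LATTICE LINES at every separation `1 ≤ j ≤ L^k` (repair R-β″, PRODUCER HALF; twin of n16-a's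
# file 13 §1 `N16.thm4OutputPrint_of_thm4TorusAt_print`)

Cell `pub-ymgap`, seat `pub-ymgap-dag-n16-c` (R134 fan-out seat, strategy s1; HUMAN RULING D-0062; chair R424 venue), generation 4, file 31.
`--supports stmt-QuantumFields-19912 --as helper` (K3‴ `SpineGivenEndpointR13`, route rev 16).  `bears_on: R4∕N16 · edge N05 → N16`.  Located item:
`HOME/pub-ymgap-dag-n16-c/LOCATED-N16-HOLDER-PIN.md`, census row R-β″ (ADDENDUM 5).  Consumer of this file: file 29 `N16HolderMSPrintLetters` ((OUT_print-MS) ⟹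
(OUT₁₃₈-MS)); producer of its hypothesis (successor): the MS twins of g0's `Thm4TorusOfZd` ∕ `Thm4ZdPrintOfLeaf` ∕ `OfLeaf` over brick 2 `N16HolderMSReadouts`.

WHY.  n16-a's (T4ᵀ_print) fills [Balaban1985RegularSpaces] Theorem 4's conclusion slot `Concl` (n16-b's `B8Thm4TorusAt.Thm4TorusAt`, slot FREE) with print's
(1.36)∕(1.38)∕(1.39) letters, the (1.36)₃ Hölder line at nearest-neighbour distance along `μ`.  (T4ᵀ_print-MS) is the same slot with that line read along every
lattice line, «`‖Ad (hol U₀ y (seg μ j)) (D^η_{U₀,μ}A_κ)(y+j•e_μ) − D^η_{U₀,μ}A_κ(y)‖ ≤ B_h(α₀+α₁)·ξ^{kβ}·j^β`, `1 ≤ j ≤ L^k`» ([Balaban1985BackgroundPropagators] (3.40)'s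
transported quotient along the straight contour, brick 2's `trans_line_eq_conjR_hol_seg`).  n16-a's proof (Theorem 4 at the pair via n16-b's `concl_of_thm4TorusAt_pair`,
the pair in `𝔄_k` and (3.35) by n16-b's `PairClassAkB8` ∕ `PairReg335B8`) passes the slot's conjuncts through, so it passes the multi-scale line through: THIS FILE
is that theorem with the slot and the conclusion (OUT_print-MS) = file 29's hypothesis `hOut`.

WHAT THIS FILE PROVES (kernel, theorems only, 0 `def`, 0 sorry): `thm4OutputPrintMS_of_thm4TorusAt_printMS`.
HONEST FRAMING: bookkeeping over LANDED theorems by name; (T4ᵀ_print-MS) is [Balaban1985RegularSpaces] Thm 4 + Prop 3 (torus geometry) TYPE — node N05's theorem,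
NOT proved in the tree; (H3ˢᵘᵖ) = N07's [Balaban1985Variational] Thm 1 TYPE; N16 ∕ NE3 NOT discharged; count-neutral; one finite four-torus at fixed ε — NOT ℝ⁴,
NOT infinite volume, NOT OS, NOT a mass gap, NOT Clay.
-/

set_option autoImplicit false

open scoped BigOperators Matrix Matrix.Norms.L2Operator
open NormedSpace

namespace Summit.QuantumFields.YangMills.BalabanUVNodes.N16HolderMSThm4Print

open Literature.MathematicalPhysics.QuantumFieldTheory.Balaban1983to89
open B7Prop1Explicit B7Prop2Explicit
open T4AveragingDeficitWall (IsUnitaryCfg Ad fineAction blockSites)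
open T4AveragingDeficitWallBoundary (periodBox)
open T4EtaRateMin (NE3Shape)
open B8Lemma1NonAbelian (pert)
open B7Eq92Concrete (mgauge)
open B8Ineq132 (covDerivFwd InAk)
open B8Eq146AExpansion (iEta)
open B8Eq184Proof (cfgExp)
open B8Eq119TwistedAxial (Restr129)
open B8Eq166ConstraintPair (ptw)
open B8Eq133Hypotheses (Reg335Zd)
open B8Eq138LandauZd (covLap IsLandau138)
open B8Thm4TorusAt (torusLam torusLam_self Thm4TorusAt concl_of_thm4TorusAt_pair)
open B12Ineq417Flat (shiftCfg)
open Summit.QuantumFields.BalabanUV.T4Continuum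
open MinimalActionSandwich (IsMinimiser)
open MinimalActionRate (Regular sfClass rescale_bavg_mem_sfClass minActReadings)
open MinimalActionRefine (RegularSup gradConst)
open BlockAverageCurrent (curConst curConst_nonneg)
open NE3EnergyShapes (IsPeriodicSite)
open NE3EnergyWeightedCovShape (NE3EnergyRateWCov)
open NE3RightInverseSupLetters (frameC)
open NE3.LeafIndexSockets (LeafH3sup)
open NE3.SupplierB8SfClassPrep (pdev_le_of_smallField)
open NE3.RemainderTowerPrepB8 (shiftCfg_of_isPeriodicCfg)
open NE3.PairFrameCondition (avgIter_eq_of_isMinimiser avgIter_rescale_bavg_eq_of_isMinimiser)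
open NE3.PairClassAkB8 (inAk_pair)
open NE3.PairReg335B8 (reg335Zd_rescale_bavg)

noncomputable section

variable {d : ℕ} {n : Type*} [Fintype n] [DecidableEq n]

/-- **THEOREM 4 (TORUS GEOMETRY) WITH THE CONCRETE CONCLUSION SLOT, HÖLDER LINE MULTI-SCALE, YIELDS (OUT_print-MS)** (any `d ≥ 1`, `L ≥ 2`) — n16-a's
`N16.thm4OutputPrint_of_thm4TorusAt_print` token for token with the slot's (1.36)₃ conjunct read along every lattice line (`1 ≤ j ≤ L^k`, transport
`Ad (hol U₀ y (seg μ j))`); the conclusion is file 29's (OUT_print-MS) at `(s, g′, B_h) = (B(α+11d²α), B(α+11d²α), B_h(α+11d²α))`.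
[cite: Balaban1985RegularSpaces, Thm 4 p.88, (1.36)–(1.38) p.82, (1.39) p.83; Balaban1985BackgroundPropagators, (3.40) p.397] [folklore] -/
theorem thm4OutputPrintMS_of_thm4TorusAt_printMS [Nonempty n] (hd : 1 ≤ d) {L N : ℕ} (hL : 2 ≤ L) {ε b g b' c' α c₁ B Bh β : ℝ}
    (hε : 0 ≤ ε) (hb' : 0 ≤ b') (hc' : 0 ≤ c') (hb'1 : b' ≤ 1) (hRb : 2 ^ 15 * ((d : ℝ) + 1) ^ 2 * ((d : ℝ) + 4) ^ 2 * (L : ℝ) ^ 2 * b' ≤ 1)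
    (hb'α : b' + 226 * (8 * (d + 1) * (d + 4)) ^ 2 * b' ^ 2 < α) (hc'α : 4 * ((d : ℝ) - 1) * (c' + curConst d L * b' ^ 2) < α)
    (hα : 0 < α) (hεα : ε < α) (hα3 : C0 d * α ≤ 1 / 3) (hα2 : 2 * α ≤ c2' d L) (hsmall : 11 * (d : ℝ) ^ 2 * α ≤ 1 / 6)
    (hc₁ : α + 11 * (d : ℝ) ^ 2 * α ≤ c₁)
    {Mc : ℝ} (hMc : 0 ≤ Mc) (hMcα : (Mc + 1) * (b' + 226 * (8 * (d + 1) * (d + 4)) ^ 2 * b' ^ 2) ≤ 1 / 2)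
    {𝒬 : ℕ → Set (Set (Site d) × ℕ)}
    (h𝒬 : ∀ k, ∀ q ∈ 𝒬 k, q.2 ≤ k ∧ ∃ y : Site d, ∀ z ∈ q.1, (l1 (z - y) : ℝ) ≤ Mc * (L : ℝ) ^ q.2)
    {C : ℝ} (hC : 2 * (Mc + 1) * (b' + 226 * (8 * (d + 1) * (d + 4)) ^ 2 * b' ^ 2) + 2 * Mc * (2 * (c' + curConst d L * b' ^ 2)) +
      4 * Mc * (1 + 2 * Mc) * (b' + 226 * (8 * (d + 1) * (d + 4)) ^ 2 * b' ^ 2) ^ 2 < C)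
    (hT4 : ∀ k, 1 ≤ k → Thm4TorusAt L k (((N * L ^ k : ℕ) : ℤ)) (((L : ℝ) ^ k)⁻¹) c₁ (unitaryUnits (Matrix n n ℂ))
      (Reg335Zd (((L : ℝ) ^ k)⁻¹) L (𝒬 k) C) (Restr129 L k (torusLam k))
      (fun (α₀ α₁ : ℝ) (U₀ U' : Site d → Fin d → (Matrix n n ℂ)ˣ) (u : Site d → (Matrix n n ℂ)ˣ) =>
        ∃ A : Site d → Fin d → Matrix n n ℂ,
          (∀ x μ, IsSelfAdjoint (A x μ)) ∧ (∀ (x : Site d) (κ μ : Fin d), A (x + (((N * L ^ k : ℕ) : ℤ)) • e κ) μ = A x μ) ∧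
          mgauge U₀ u (cfgExp (((L : ℝ) ^ k)⁻¹) A) = U' ∧
          (∀ x μ, ‖A x μ‖ ≤ B * (α₀ + α₁)) ∧
          (∀ (μ : Fin d) (x : Site d) (κ : Fin d), ‖covDerivFwd (((L : ℝ) ^ k)⁻¹) U₀ μ (fun z => A z κ) x‖ ≤ B * (α₀ + α₁)) ∧
          IsLandau138 L k (((L : ℝ) ^ k)⁻¹) Set.univ (torusLam k) U₀ A ∧
          (∀ (κ μ : Fin d) (y : Site d) (j : ℕ), 1 ≤ j → j ≤ L ^ k →
            ‖Ad (hol U₀ y (seg μ (j : ℤ))) (covDerivFwd (((L : ℝ) ^ k)⁻¹) U₀ μ (fun z => A z κ) (y + j • e μ))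
                - covDerivFwd (((L : ℝ) ^ k)⁻¹) U₀ μ (fun z => A z κ) y‖
              ≤ Bh * (α₀ + α₁) * ((((L : ℝ)⁻¹) ^ k) ^ β * (j : ℝ) ^ β)) ∧
          (∀ (x : Site d) (κ : Fin d), ‖covLap (((L : ℝ) ^ k)⁻¹) U₀ (fun z => A z κ) x‖ ≤ B * (α₀ + α₁))))
    {dom : Set (Site d → Fin d → (Matrix n n ℂ)ˣ)}
    (h3 : LeafH3sup d L N ε b' c' dom) :
    ∀ k : ℕ, 1 ≤ k → ∀ V ∈ dom, ∀ UA UB : Site d → Fin d → (Matrix n n ℂ)ˣ,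
      IsMinimiser d (sfClass d L N ε) L N k V UA → IsMinimiser d (sfClass d L N ε) L N (k + 1) V UB → Regular d L N b g (k + 1) UB →
      ∃ u : Site d → (Matrix n n ℂ)ˣ, (∀ x, u x ∈ unitaryUnits (Matrix n n ℂ)) ∧ IsPeriodicSite u (((N * L ^ k : ℕ) : ℤ)) ∧
        (∃ Λ : ℕ → Set (Site d), Λ k = Set.univ ∧ Restr129 L k Λ (rescale L (bavg L UB)) u) ∧
        ∃ A : Site d → Fin d → Matrix n n ℂ,
          (∀ x μ, IsSelfAdjoint (A x μ)) ∧ (∀ (x : Site d) (κ μ : Fin d), A (x + (((N * L ^ k : ℕ) : ℤ)) • e κ) μ = A x μ) ∧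
          mgauge (rescale L (bavg L UB)) u (cfgExp (((L : ℝ) ^ k)⁻¹) A)
            = pert (gaugeAct (ptw L (rescale L (bavg L UB)) UA k) UA) (rescale L (bavg L UB)) ∧
          (∀ x μ, ‖A x μ‖ ≤ B * (α + 11 * (d : ℝ) ^ 2 * α)) ∧
          (∀ (μ : Fin d) (x : Site d) (κ : Fin d), ‖covDerivFwd (((L : ℝ) ^ k)⁻¹) (rescale L (bavg L UB)) μ (fun z => A z κ) x‖ ≤ B * (α + 11 * (d : ℝ) ^ 2 * α)) ∧
          IsLandau138 L k (((L : ℝ) ^ k)⁻¹) Set.univ (torusLam k) (rescale L (bavg L UB)) A ∧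
          (∀ (κ μ : Fin d) (y : Site d) (j : ℕ), 1 ≤ j → j ≤ L ^ k →
            ‖Ad (hol (rescale L (bavg L UB)) y (seg μ (j : ℤ)))
                  (covDerivFwd (((L : ℝ) ^ k)⁻¹) (rescale L (bavg L UB)) μ (fun z => A z κ) (y + j • e μ))
                - covDerivFwd (((L : ℝ) ^ k)⁻¹) (rescale L (bavg L UB)) μ (fun z => A z κ) y‖
              ≤ Bh * (α + 11 * (d : ℝ) ^ 2 * α) * ((((L : ℝ)⁻¹) ^ k) ^ β * (j : ℝ) ^ β)) ∧
          (∀ (x : Site d) (κ : Fin d), ‖covLap (((L : ℝ) ^ k)⁻¹) (rescale L (bavg L UB)) (fun z => A z κ) x‖ ≤ B * (α + 11 * (d : ℝ) ^ 2 * α)) := by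
  intro k hk V hV UA UB hA hB _
  have hL1 : 1 ≤ L := le_trans (by norm_num) hL
  have hL2 : (2 : ℝ) ≤ L := by exact_mod_cast hL
  -- both minimisers are `RegularSup b′ c′` by (H3ˢᵘᵖ) (levels `k ≥ 1`, `k + 1`)
  obtain ⟨k', rfl⟩ : ∃ k', k = k' + 1 := ⟨k - 1, by omega⟩
  have hregA : RegularSup d L N b' c' (k' + 1) UA := h3 V hV k' UA hA
  have hregB : RegularSup d L N b' c' (k' + 1 + 1) UB := h3 V hV (k' + 1) UB hB
  have hb4 : b' / ((L : ℝ) ^ (k' + 1)) ^ 2 ≤ 1 / 4 := by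
    have hLk2 : (2 : ℝ) ≤ (L : ℝ) ^ (k' + 1) := by
      calc (2 : ℝ) = 2 ^ 1 := by norm_num
        _ ≤ (L : ℝ) ^ 1 := by gcongr
        _ ≤ (L : ℝ) ^ (k' + 1) := pow_le_pow_right₀ (by linarith only [hL2]) (by omega)
    have h4 : (4 : ℝ) ≤ ((L : ℝ) ^ (k' + 1)) ^ 2 := by nlinarith only [hLk2]
    rw [div_le_div_iff₀ (by positivity) (by norm_num)]
    nlinarith only [h4, hb'1, hb']
  -- the pair's data: `W = rescale L (bavg L U_B)` and `U_A` unitary, periodic, small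
  obtain ⟨hAu, hAP, hAsm⟩ := hA.mem.1
  have hbs' : 512 * (d + 1) * (d + 4) * (L : ℝ) ^ 2 * b' ≤ 1 := by
    have hd0 : (0 : ℝ) ≤ d := Nat.cast_nonneg d
    have hL2b : 0 ≤ (L : ℝ) ^ 2 * b' := by positivity
    have hX : (4 : ℝ) ≤ ((d : ℝ) + 1) * ((d : ℝ) + 4) := by nlinarith only [hd0]
    have h1 : (512 : ℝ) * (d + 1) * (d + 4) ≤ 2 ^ 15 * ((d : ℝ) + 1) ^ 2 * ((d : ℝ) + 4) ^ 2 := by nlinarith only [hX, hd0]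
    calc 512 * (d + 1) * (d + 4) * (L : ℝ) ^ 2 * b' = (512 * (d + 1) * (d + 4)) * ((L : ℝ) ^ 2 * b') := by ring
      _ ≤ (2 ^ 15 * ((d : ℝ) + 1) ^ 2 * ((d : ℝ) + 4) ^ 2) * ((L : ℝ) ^ 2 * b') := mul_le_mul_of_nonneg_right h1 hL2b
      _ = 2 ^ 15 * ((d : ℝ) + 1) ^ 2 * ((d : ℝ) + 4) ^ 2 * (L : ℝ) ^ 2 * b' := by ring
      _ ≤ 1 := hRb
  obtain ⟨hWu, hWP, hWsm⟩ := rescale_bavg_mem_sfClass hL1 hb' hbs' le_rfl hregB.regular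
  have hαW0 : 0 ≤ b' + 226 * (8 * (d + 1) * (d + 4)) ^ 2 * b' ^ 2 := by positivity
  have h34 : pdev UA < α * (((L : ℝ) ^ (k' + 1))⁻¹) ^ 2 := by
    refine (pdev_le_of_smallField (div_nonneg hε (by positivity)) hAsm).trans_lt ?_
    rw [inv_pow, ← div_eq_mul_inv]; exact div_lt_div_of_pos_right hεα (by positivity)
  have h33 : pdev (rescale L (bavg L UB)) < α * (((L : ℝ) ^ (k' + 1))⁻¹) ^ 2 := by
    refine (pdev_le_of_smallField (div_nonneg hαW0 (by positivity)) hWsm).trans_lt ?_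
    rw [inv_pow, ← div_eq_mul_inv]; exact div_lt_div_of_pos_right hb'α (by positivity)
  have hpair : avgIter L UA (k' + 1) = avgIter L (rescale L (bavg L UB)) (k' + 1) := by
    rw [avgIter_eq_of_isMinimiser hA, avgIter_rescale_bavg_eq_of_isMinimiser hB]
  have hAshift : ∀ i : Fin d, shiftCfg (((N * L ^ (k' + 1) : ℕ) : ℤ) • e i) UA = UA := fun i => shiftCfg_of_isPeriodicCfg hAP (e i)
  have hWshift : ∀ i : Fin d, shiftCfg (((N * L ^ (k' + 1) : ℕ) : ℤ) • e i) (rescale L (bavg L UB)) = rescale L (bavg L UB) :=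
    fun i => shiftCfg_of_isPeriodicCfg hWP (e i)
  -- (1.33) first clause ∕ (1.34): both data in `𝔄_k({T_η}, α)` (n16-b's g0 `PairClassAkB8`)
  obtain ⟨hAkW, hAkA, -⟩ := inAk_pair hd hL1 hA hB hregA hregB hb' hc' hb4 hRb hα.le hb'α hc'α (fun _ => Set.univ)
    (u₀ := fun _ => (1 : (Matrix n n ℂ)ˣ)) (fun _ => (unitaryUnits (Matrix n n ℂ)).one_mem)
  -- (1.33) second clause: [Balaban1985BackgroundPropagators] (3.35) at `W` (n16-b's g2 `PairReg335B8`)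
  have hReg : Reg335Zd (((L : ℝ) ^ (k' + 1))⁻¹) L (𝒬 (k' + 1)) C (rescale L (bavg L UB)) :=
    reg335Zd_rescale_bavg hL1 hregB hb' hc' hRb hMc hMcα (h𝒬 (k' + 1)) hC
  -- Theorem 4 (torus geometry) applies at the pair (n16-b's F6): the unique periodic `u` with (1.29) on `Λ_k = T^{(k)}` and `Concl`
  obtain ⟨u, ⟨hu, huP, hres, hconcl⟩, -⟩ := by
    letI : CStarAlgebra (Matrix n n ℂ) := {}
    have hG := avgClosed_unitaryUnits d (𝔸 := Matrix n n ℂ) L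
    exact concl_of_thm4TorusAt_pair L hL hd hG N (k' + 1) (hT4 (k' + 1) hk) (rescale L (bavg L UB)) UA hWu hAu hWshift hAshift hα hα3
      hα2 h33 h34 hpair hsmall hc₁ hAkW hReg hAkA
  -- the Concl-dictionary: print's (1.36)∕(1.38)∕(1.62) letters at the pair
  -- the concrete conclusion slot: print's (1.36)∕(1.38)∕(1.39) letters at the pair
  obtain ⟨A, hAsa, hAper, hmg, hs, hg, h138, hhol, hlap⟩ := hconcl
  exact ⟨u, hu, huP, ⟨torusLam (k' + 1), torusLam_self _, hres⟩, A, hAsa, hAper, hmg, hs, hg, h138, hhol, hlap⟩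

end

end Summit.QuantumFields.YangMills.BalabanUVNodes.N16HolderMSThm4Print
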